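import Summits.AtomisticToContinuum.Crystallization.Theorems.FrustratedLawDichotomyStrainedPatchHomCurvLeafL2Smoke

/-!
# KERNEL TESTS of the centred curvature leaf v2 under STRAIN: entry scale `.010` at `U ± 2⁻⁹ × ξ ± 0.005`, and `.050` at `U ± 2⁻¹⁰ × ξ ± 0.0025`

decomp-a2c hand-1 g27 (crux `AperiodicFrustratedLawGap`, stmt-AtomisticToContinuum-27623; `(H) HomFloor (1/625)`, hcp half; lever (C); critic rows
1040 (b) / 1044: «certified λ vs sampled at entry scales .010/.025/.050, kill sign < ½»).  Boxes = the strained samples of hand-1 g26's `LamReport`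
(symmetric `U` at entry scale `.010` resp. `.050`, centred at the relaxed shuffle `ξ⋆(U)`), label split as in `…HomCurvLeafL2Smoke` (in-kernel).
Compiled evaluation: `.010` box certified `5.07` (sampled `λ_min` at the centre `7.16`, ratio `0.71`); `.050` box at the finer granularity
certified `2.29` (sampled `3.34`, ratio `0.69`).  The kernel confirms `λ = 9/2` resp. `λ = 2`.

Test data definitions + two kernel theorems; 0 sorry; standard axioms; no instances / notation / `#eval`.  `--supports stmt-AtomisticToContinuum-27623`.
-/

namespace Summit.AtomisticToContinuum.Crystallization.Theorems.FrustratedLawDichotomyStrainedPatchHomCurvLeafL2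

open Literature.Analysis.ValidatedNumerics.Numerics
open Summit.AtomisticToContinuum.Crystallization.Theorems.FrustratedLawDichotomyStrainedPatchHomCurvLeaf (nearLabels)

/-- Strained box centre, entry scale `.010` (hand-1 g26 LamReport sample `e010`): `U` entries and `ξ⋆(U)`, scaled. -/
def c010 : (Fin 3 × Fin 3) ⊕ Fin 3 → ℤ :=
  Sum.elim (fun ab => (![![276205765146632, 1125899906843, -2251799813685], ![1125899906843, 271983640495973, 1688849860264],
    ![-2251799813685, 1688849860264, 274184774813850]] : Fin 3 → Fin 3 → ℤ) ab.1 ab.2) ![-1200452687327, -1713780540941, 11271105677]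

/-- Strained box centre, entry scale `.050` (sample `e050`). -/
def c050 : (Fin 3 × Fin 3) ⊕ Fin 3 → ℤ :=
  Sum.elim (fun ab => (![![263539391194653, -14073748835533, 8444249301320], ![-14073748835533, 286057389331505, 7036874417766],
    ![8444249301320, 7036874417766, 270525600116611]] : Fin 3 → Fin 3 → ℤ) ab.1 ab.2) ![24792514906927, 14828698637155, 638774018106]

/-- Half-widths `2⁻¹⁰` (entries) and `0.0025` (shuffle), scaled. -/
def wFine : (Fin 3 × Fin 3) ⊕ Fin 3 → ℤ := Sum.elim (fun _ => 274877906944) (fun _ => 703687441777)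

/-- Centred labels of a box (v2 selector, in the kernel). -/
def cenOf (c w : (Fin 3 × Fin 3) ⊕ Fin 3 → ℤ) : List (Fin 3 → ℤ) := (nearLabels c w 2209 100).filter fun b => isCenL2 c w b
/-- Naive labels of a box (in the kernel). -/
def naiOf (c w : (Fin 3 × Fin 3) ⊕ Fin 3 → ℤ) : List (Fin 3 → ℤ) := (nearLabels c w 2209 100).filter fun b => !(isCenL2 c w b)

/-- ★ KERNEL TEST (strain .010, `U ± 2⁻⁹ × ξ ± 0.005`): floor `λ = 9/2` certified. -/
theorem curvCheckL2_e010 : curvCheckL2 c010 wStar2 (cenOf c010 wStar2) (naiOf c010 wStar2) (9 * 140737488355328) = true := by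
  decide +kernel

/-- ★ KERNEL TEST (strain .050, `U ± 2⁻¹⁰ × ξ ± 0.0025`): floor `λ = 2` certified. -/
theorem curvCheckL2_e050 : curvCheckL2 c050 wFine (cenOf c050 wFine) (naiOf c050 wFine) (2 * 281474976710656) = true := by
  decide +kernel

end Summit.AtomisticToContinuum.Crystallization.Theorems.FrustratedLawDichotomyStrainedPatchHomCurvLeafL2
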